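import Summits.FinalStateConjecture.FinalStateConjecture.Theorems.PhaseMixingCaptureBulkKerrCaptureC2ReflectionConvergence
import Summits.FinalStateConjecture.FinalStateConjecture.Theorems.PhaseMixingCaptureBulkKerrCaptureC2Centre
import HarnessLib

/-!
# Crux `PhaseMixingCapture.BulkKerrCaptureC2` (stmt-FinalStateConjecture-14985): SPIN REVERSAL — at the centre datum the
# conclusion holds with BOTH final spins `±a`; the parameter clause alone fixes the sign

Support file for the crux `BulkKerrCaptureC2`, sequel of `…ReflectionConvergence` (`Cᵏ`-convergence to `g_{M,a}` and
to `g_{M,−a}` are the same property) and `…Centre` (every maximal vacuum Cauchy development of the exact datum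
`Kerr.data M a M` is far-complete with a region converging in `Cᵏ` to `g_{M,a}`).  Put together:

* `centre_converges_both_signs` — every MGHD of `Kerr.data M a M`, `|a| < M`, has ONE region converging in `Cᵏ` to
  `g_{M,a}` AND to `g_{M,−a}`;
* `captureC2At_centre_witness_neg` — at the centre datum the conclusion of the crux also holds with the witness
  `(M', a') = (M, −a)`, for every tolerance `η ≥ 2|a|`;
* **`not_existsUnique_witness_centre`** — consequently, for a rotating centre (`a ≠ 0`) and `η ≥ 2|a|`, the
  `∃!`-STRENGTHENING of the conclusion ("a UNIQUE sub-extremal pair `(M', a')` within `η` whose metric is the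
  `C²`-limit of a region") is FALSE at every MGHD of `Kerr.data M a M`.  The sign of the final spin is pinned by the
  parameter clause `|M' − M| + |a' − a| ≤ η` with `η < 2|a|` and by nothing else in the conclusion; a refuter grading
  uniqueness strengthenings of the crux, or a planner tempted to state one, is answered here.

Nothing here asserts or refutes the crux.  Everything is proved; no definitions, no named facts.  References:
B. O'Neill (1995), Ch. 2, §2.1–2.2 (the Kerr family and `a ↦ −a`); M. Dafermos, G. Holzegel, I. Rodnianski, M. Taylor,
arXiv:2104.08222, §1 (consequence-form convergence); H. Ringström (2009), Def. 16.5.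
-/

-- the doubled `FinalStateConjecture.FinalStateConjecture` path component trips dupNamespace
set_option linter.dupNamespace false

noncomputable section

open Set Function Topology
open scoped Manifold ContDiff Topology
open Literature.Geometry.Lorentzian
open Summit.FinalStateConjecture.FinalStateConjecture.Theorems.BulkKerrCaptureC2.Centre (conclusion_centre)
open Summit.FinalStateConjecture.FinalStateConjecture.Theorems.ZeroEnergyRigidity.Negative (isSubextremal_neg_iff)

namespace Summit.FinalStateConjecture.FinalStateConjecture.Theorems.BulkKerrCaptureC2.Reflection

variable [Kerr.Facts] [Kerr.SliceFacts] {M a : ℝ}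

/-- **Every MGHD of the exact Kerr datum converges to `g_{M,a}` AND to `g_{M,−a}`**, in one and the same region
(`Centre.conclusion_centre` and the orientation blindness `convergesToKerr_neg`). [cite: Ringstrom2009, Def. 16.5] -/
theorem centre_converges_both_signs (hM : 0 < M) (ha : |a| < M) (k : ℕ)
    (𝒟 : VacuumCauchyDevelopment (Kerr.data M a M hM.le)) (hmax : 𝒟.IsMaximal) :
    ∃ 𝒟oc : Set 𝒟.carrier,
      𝒟.toSpacetime.ConvergesToKerr 𝒟oc M a k ∧ 𝒟.toSpacetime.ConvergesToKerr 𝒟oc M (-a) k := by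
  obtain ⟨-, 𝒟oc, hconv⟩ := conclusion_centre hM ha k 𝒟 hmax
  exact ⟨𝒟oc, hconv, convergesToKerr_neg 𝒟.toSpacetime hconv⟩

/-- **At the centre datum the conclusion of the crux holds with the REVERSED witness `(M, −a)`** whenever the
tolerance allows it, `2|a| ≤ η`: far-completeness and convergence to `g_{M,−a}` (`centre_converges_both_signs`),
`|M − M| + |−a − a| = 2|a| ≤ η`. [cite: Ringstrom2009, Def. 16.5] -/
theorem captureC2At_centre_witness_neg (hM : 0 < M) (ha : |a| < M) {η : ℝ} (hη : 2 * |a| ≤ η)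
    (𝒟 : VacuumCauchyDevelopment (Kerr.data M a M hM.le)) (hmax : 𝒟.IsMaximal) :
    ∃ 𝒟oc : Set 𝒟.carrier, Kerr.IsSubextremal M (-a) ∧ 𝒟.HasCompleteFutureNullInfinityFar ∧
      𝒟.toSpacetime.ConvergesToKerr 𝒟oc M (-a) 2 ∧ |M - M| + |(-a) - a| ≤ η := by
  obtain ⟨hfar, 𝒟oc, hconv⟩ := conclusion_centre hM ha 2 𝒟 hmax
  refine ⟨𝒟oc, (isSubextremal_neg_iff M a).2 ha, hfar, convergesToKerr_neg 𝒟.toSpacetime hconv, ?_⟩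
  have e : -a - a = -(2 * a) := by ring
  rw [sub_self, abs_zero, zero_add, e, abs_neg, abs_mul, abs_two]
  exact hη

/-- **The `∃!`-strengthening of the conclusion is false at every rotating centre.**  For `0 < M`, `0 < |a| < M`,
`2|a| ≤ η` and ANY maximal vacuum Cauchy development `𝒟` of `Kerr.data M a M`, it is NOT the case that there is a
unique pair `(M', a')` admitting a region `𝒟oc` with `(M', a')` sub-extremal, `𝒟` far-complete, `𝒟oc` converging in
`C²` to `g_{M',a'}` and `|M' − M| + |a' − a| ≤ η`: both `(M, a)` (`Centre.conclusion_centre`) and `(M, −a)`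
(`captureC2At_centre_witness_neg`) qualify, and they differ.  So within the conclusion of the crux the sign of the final
spin is fixed by the parameter clause with `η < 2|a|` and by nothing else.  O'Neill 1995, Ch. 2, §2.1–2.2.
[cite: ONeill1995, Ch. 2 §2.1] -/
theorem not_existsUnique_witness_centre (hM : 0 < M) (ha : |a| < M) (ha0 : a ≠ 0) {η : ℝ} (hη : 2 * |a| ≤ η)
    (𝒟 : VacuumCauchyDevelopment (Kerr.data M a M hM.le)) (hmax : 𝒟.IsMaximal) :
    ¬ ∃! p : ℝ × ℝ, ∃ 𝒟oc : Set 𝒟.carrier, Kerr.IsSubextremal p.1 p.2 ∧ 𝒟.HasCompleteFutureNullInfinityFar ∧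
        𝒟.toSpacetime.ConvergesToKerr 𝒟oc p.1 p.2 2 ∧ |p.1 - M| + |p.2 - a| ≤ η := by
  intro huniq
  have hη0 : 0 ≤ η := le_trans (by positivity) hη
  -- both `(M, a)` and `(M, −a)` qualify
  have h₁ : ∃ 𝒟oc : Set 𝒟.carrier, Kerr.IsSubextremal M a ∧ 𝒟.HasCompleteFutureNullInfinityFar ∧
      𝒟.toSpacetime.ConvergesToKerr 𝒟oc M a 2 ∧ |M - M| + |a - a| ≤ η := by
    obtain ⟨hfar, 𝒟oc, hconv⟩ := conclusion_centre hM ha 2 𝒟 hmax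
    exact ⟨𝒟oc, ha, hfar, hconv, by simpa using hη0⟩
  have h₂ := captureC2At_centre_witness_neg hM ha hη 𝒟 hmax
  have heq : ((M, a) : ℝ × ℝ) = (M, -a) := huniq.unique h₁ h₂
  have : a = -a := congrArg Prod.snd heq
  exact ha0 (by linarith)

omit [Kerr.Facts] [Kerr.SliceFacts] in
/-- **Registered sub-goal `stub_not_existsUnique_witness_centre`** (crux item stmt-FinalStateConjecture-14985): the
`∃!`-strengthening of the conclusion of the crux fails at every rotating centre datum for `η ≥ 2|a|` (closed form of
`not_existsUnique_witness_centre`). [cite: ONeill1995, Ch. 2 §2.1] -/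
theorem stub_not_existsUnique_witness_centre : ∀ [Kerr.Facts] [Kerr.SliceFacts] (M : ℝ) (hM : 0 < M) (a : ℝ), |a| < M → a ≠ 0 → ∀ η : ℝ, 2 * |a| ≤ η → ∀ (𝒟 : VacuumCauchyDevelopment (Kerr.data M a M hM.le)), 𝒟.IsMaximal → ¬ ∃! p : ℝ × ℝ, ∃ 𝒟oc : Set 𝒟.carrier, Kerr.IsSubextremal p.1 p.2 ∧ 𝒟.HasCompleteFutureNullInfinityFar ∧ 𝒟.toSpacetime.ConvergesToKerr 𝒟oc p.1 p.2 2 ∧ |p.1 - M| + |p.2 - a| ≤ η :=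
  fun _ hM _ ha ha0 _ hη 𝒟 hmax ↦ not_existsUnique_witness_centre hM ha ha0 hη 𝒟 hmax

end Summit.FinalStateConjecture.FinalStateConjecture.Theorems.BulkKerrCaptureC2.Reflection

end
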